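import Literature.IUT.LogVolume.IdealArithmeticDivisors
import Literature.IUT.LogVolume.FakeAdeleIndex
import Mathlib.NumberTheory.NumberField.Discriminant.Different
import Mathlib.FieldTheory.Galois.Basic
import Mathlib.LinearAlgebra.Matrix.GeneralLinearGroup.Defs
import Mathlib.Data.ZMod.Basic
import HarnessLib

/-!
# Joshi, *Arithmetic Teichmüller spaces IV* [J-IV] §4.1–§4.3 — the basic set-up, differents and discriminants

Record file of the abc-iut cell, branch E «type Joshi's construction, test vs S» (rung LADDER-ABC:A2.E; seat abc-iut-E-t26,
slot T-26 of plan/E/ASSIGNMENTS.md; JOSHI-DAG nodes J4:Prop4.1.1, J4:Lem4.1.2, J4:Rmk4.1.3, J4:Prop4.3.5 and the un-numbered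
items §4.1.1 (1)–(5), §4.1.2 (6), §4.2.1, (4.3.1)–(4.3.4); the companion `Joshi/ATS4RamificationTateDivisor.lean` types §4.2's
relative invariants, §4.1.2 (7)–(9), Lemma 4.1.4 and §4.4, independently). TAKES NO SIDE on [IUTchIII] Cor. 3.12, on Joshi's
claims, or on Mochizuki's reports on them; typed ≠ proved ≠ endorsed. Source: K. Joshi, *Construction of Arithmetic
Teichmuller Spaces IV: Proof of the abc-conjecture*, arXiv:2403.10430v2 (2024), UNREFEREED preprint («Preliminary version for
comments»), bib `Joshi2024ATS4`; locators «p.N l.a–b» = lines a–b of page file `pNNNN.txt` of the cell render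
`HOME/lit/renders/Joshi-arxiv-2403.10430/` (PDF page N).

## What is typed here, and how (plan/E/E-PLAN.md R6/R14: Joshi's DATA as `structure`/`def`, everything he ASSERTS as a named
## `Prop` tagged `@[claim "Joshi2024ATS4" "disputed"]`, never asserted; what FOLLOWS from the typed signature is PROVED;
## imports = Mathlib + `Literature.IUT.LogVolume` only)

* §4.1 (p.37 l.7–p.38 l.31): the constants `d_mod = [L_mod : ℚ]`, `d*_mod = 2¹²·3³·5·d_mod`, `e_mod = max_v e_v`, `e*_mod`
  (§4.1.1 (2)–(5)) over a genuine Mathlib number field; the printed ASSUMPTION (4) «`e_mod ≤ d_mod`» is PROVED (`eMod_le_dMod`: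
  `e_v ≤ e_v f_v ≤ Σ_{v ∣ p} e_v f_v = [L_mod : ℚ]`) — it holds for every number field. The reduction-type hypotheses §4.1.1 (1),
  §4.1.2 (6) and Proposition 4.1.1 are typed over an abstract reduction signature `ReductionDatum L` (the elliptic curve `C/L` of
  the Initial Theta Data is NOT an object of this file: merge-debt = slot T-06 `Joshi/InitialThetaDataJoshi.lean`, J3 §3 (6)–(8)
  `Voddss`); Lemma 4.1.2 (`Gal(L/L_mod) ↪ ℤ/2 × GL₂(𝔽₂) × GL₂(𝔽₃) × GL₂(𝔽₅)`) is a claim-`Prop` over genuine fields `L_mod → L`.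
* §4.2.1 (p.39 l.13–39): Joshi's arithmetic divisors `a_M = Σ_v c_v·v`, `c_v ∈ ℝ`, with `deg` (4.2.1) and the normalized
  `log(a_M) = deg(a_M)/[M:ℚ]` (4.2.2) ARE the tree's `ℝ`-arithmetic divisors `ADivisor M = (InfinitePlace M ⊕ 𝕍(M)^non) →₀ ℝ` with
  `degF` / `ndeg` ([IUTchIV] Def. 1.9, `RArithmeticDivisors.lean`) — cited BY NAME, not restated; the printed formula (4.2.1) is
  PROVED (`degF_eq_sum_non_add_sum_arc`). §4.2's `f_v`, `e_v`, `log v = log(p^{f_v})` are the tree's `resDeg`, `ramIdx`,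
  `logNorm` / `logNorm_eq` (`FakeAdeleIndex.lean`).
* §4.3 (p.39 l.41–p.40 l.21): `d_M = Σ_w d_{M,w}·w` IS the tree's `differentDivisor M` (coefficient at `w` = multiplicity of `w` in
  `𝔇_{𝓞M/ℤ}`; Joshi's `d_{M,w} = ord_w(diff_{𝒪_{M,w}/ℤ_p})` is the order of the COMPLETED local different, equal to it by «the
  different is preserved by completion», Serre *Local Fields* III §4 Prop. 10 = tree
  `Literature.IUT.LogVolume.differentOrd_rescaledCompletion_eq`); `log(d_M)` = `logDifferent M`; the discriminant side
  (4.3.3)–(4.3.4) is typed through Mathlib's `NumberField.discr` (`discOrd`, `logDisc`, `logDisc_eq_log_discr`); **Proposition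
  4.3.5 `log d_M = log disc_{M/ℚ}` is PROVED** (`prop435`: Mathlib `NumberField.absNorm_differentIdeal` via tree
  `degF_differentDivisor`).

Deliberately NOT here: the elliptic curve and its reduction theory; §4.1.2 (7)–(9), Lemma 4.1.4, §4.4 (companion file); any
binding to the cell's frozen `Cor312*` / `Thm311*` interface (R14: `Joshi/Dictionary*.lean` only); any judgement.
-/

noncomputable section

open NumberField IsDedekindDomain Finset
open Literature.IUT.LogVolume

namespace Summit.ABC.IUTFork.Joshi.ATS4

/-! ## 1. §4.1.1 (2)–(5): the constants `d_mod`, `d*_mod`, `e_mod`, `e*_mod` -/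

section Constants

variable (Lmod : Type*) [Field Lmod] [NumberField Lmod]

/-- §4.1.1 (2), p.37 l.36: «Let `d_mod = [L_mod : ℚ]`». [claim: Joshi2024ATS4, status: disputed] -/
def dMod : ℕ := Module.finrank ℚ Lmod

/-- §4.1.1 (3), p.37 l.37–38: «let `d*_mod = 2¹²·3³·5·d_mod`». [claim: Joshi2024ATS4, status: disputed] -/
def dStarMod : ℕ := 2 ^ 12 * 3 ^ 3 * 5 * dMod Lmod

/-- §4.1.1 (4), p.37 l.39–45: «`e_mod = max_{v ∈ V^non_{L_mod}} {e_v}`, where `e_v` is the absolute ramification index of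
`v ∈ V^non_{L_mod}`» — the supremum of the tree's `ramIdx L_mod v = e(v | p_v)` over the finite places (a maximum: `e_v = 1`
off the finitely many ramified places; bounded by `d_mod`, `ramIdx_le_dMod`). [claim: Joshi2024ATS4, status: disputed] -/
def eMod : ℕ := ⨆ v : HeightOneSpectrum (𝓞 Lmod), ramIdx Lmod v

/-- §4.1.1 (5), p.38 l.1–3: «let `e*_mod = 2¹²·3³·5·e_mod`». [claim: Joshi2024ATS4, status: disputed] -/
def eStarMod : ℕ := 2 ^ 12 * 3 ^ 3 * 5 * eMod Lmod

variable {Lmod}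

/-- `e_v ≤ [L_mod : ℚ]` for every finite place `v`: `e_v ≤ e_v·f_v = [L_{mod,v} : ℚ_{p_v}] ≤ Σ_{v' ∣ p_v} e_{v'} f_{v'}
= [L_mod : ℚ]` (tree `localDegree`, `sum_localDegree`). [folklore] -/
theorem ramIdx_le_dMod (v : HeightOneSpectrum (𝓞 Lmod)) : ramIdx Lmod v ≤ dMod Lmod := by
  haveI : Fact (residueChar Lmod v).Prime := ⟨residueChar_prime Lmod v⟩
  calc ramIdx Lmod v ≤ localDegree Lmod v :=
        Nat.le_mul_of_pos_right _ (Nat.pos_of_ne_zero (resDeg_ne_zero Lmod v))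
    _ ≤ ∑ v' ∈ placesOver Lmod (residueChar Lmod v), localDegree Lmod v' :=
        Finset.single_le_sum (fun v' _ => Nat.zero_le _) (mem_placesOver_residueChar v)
    _ = dMod Lmod := sum_localDegree Lmod (residueChar Lmod v)

/-- **§4.1.1 (4) is automatic**: the printed assumption «Assume that `e_mod ≤ d_mod`» (p.37 l.39–43) holds for every
number field. [folklore] -/
theorem eMod_le_dMod : eMod Lmod ≤ dMod Lmod := ciSup_le' ramIdx_le_dMod

/-- Each `e_v` is bounded by `e_mod` (the supremum is attained termwise since the family is bounded). [folklore] -/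
theorem ramIdx_le_eMod (v : HeightOneSpectrum (𝓞 Lmod)) : ramIdx Lmod v ≤ eMod Lmod :=
  le_ciSup (f := fun v => ramIdx Lmod v) ⟨dMod Lmod, by rintro _ ⟨v', rfl⟩; exact ramIdx_le_dMod v'⟩ v

/-- §4.1.1 (5), p.38 l.1–3: «`e*_mod = 2¹²·3³·5·e_mod ≤ d*_mod`» — PROVED from (4). [folklore] -/
theorem eStarMod_le_dStarMod : eStarMod Lmod ≤ dStarMod Lmod :=
  Nat.mul_le_mul_left _ eMod_le_dMod

end Constants

/-! ## 2. §4.1.1 (1), §4.1.2 (6), Proposition 4.1.1, Remark 4.1.3: the reduction signature of `C/L` -/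

/-- The three reduction types of an elliptic curve at a finite place (good / bad multiplicative = semi-stable bad / bad
additive), the vocabulary of [J-IV] Prop. 4.1.1 and [J-III] Lem. 3.2.1. [folklore] -/
inductive ReductionType
  /-- good reduction -/
  | good
  /-- bad, multiplicative (semi-stable) reduction -/
  | multiplicative
  /-- bad, additive reduction -/
  | additive
  deriving DecidableEq

/-- **The reduction signature of `C/L` used in §4.1** (p.37 l.13, l.29–35, p.38 l.4–10): a number field `L` (genuine), the
prime `ℓ` of §4.1.2 (6), and — as an abstract function, since the elliptic curve `C/L` of the Initial Theta Data
[J-III §2.4, §3.1, §3.3] is not an object of this file — the reduction type of `C/L` at each `v ∈ V^non_L`. SIGNATURE;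
merge-debt: slot T-06 `Joshi/InitialThetaDataJoshi.lean` (J3 §3 (6)–(8)) types `V^{odd,ss}` from a `WeierstrassCurve`.
[claim: Joshi2024ATS4, status: disputed] -/
structure ReductionDatum (L : Type*) [Field L] [NumberField L] where
  /-- the reduction type of `C/L` at the finite place `v` -/
  red : HeightOneSpectrum (𝓞 L) → ReductionType
  /-- the prime `ℓ` of §4.1.2 (6) -/
  ell : ℕ

namespace ReductionDatum

variable {L : Type*} [Field L] [NumberField L] (𝓡 : ReductionDatum L)

/-- §4.1.2 (6), p.38 l.7: «`ℓ ≥ 5` is a prime (to be chosen to be sufficiently large later on)».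
[claim: Joshi2024ATS4, status: disputed] -/
def EllHyp : Prop := 𝓡.ell.Prime ∧ 5 ≤ 𝓡.ell

/-- `V^{odd,ss}_L`: the finite places of ODD residue characteristic at which `C/L` has bad semi-stable (multiplicative)
reduction ([J-III] §3 (6), (8) «one can also define similar subsets of valuations of `L`»; [J-IV] p.38 l.15–16).
[claim: Joshi2024ATS4, status: disputed] -/
def Voddss : Set (HeightOneSpectrum (𝓞 L)) := {v | Odd (residueChar L v) ∧ 𝓡.red v = .multiplicative}

/-- «`v` divides `2·ℓ`» (p.38 l.17), i.e. the residue characteristic of `v` divides `2ℓ`.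
[claim: Joshi2024ATS4, status: disputed] -/
def DividesTwoEll (v : HeightOneSpectrum (𝓞 L)) : Prop := residueChar L v ∣ 2 * 𝓡.ell

/-- §4.1.1 (1), p.37 l.33–35: «`C/L` has good reduction at `v ∈ V^good_L ∩ V^non_L ∩ {v ∈ V_L : v does not divide (2·ℓ)}`»
(`V^good_L` = complement of `V^{odd,ss}_L`, [J-III] §3 (7)). HYPOTHESIS, typed as a `Prop`. [claim: Joshi2024ATS4, status: disputed] -/
def GoodReductionHyp : Prop := ∀ v, v ∉ 𝓡.Voddss → ¬ 𝓡.DividesTwoEll v → 𝓡.red v = .good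

/-- Proposition 4.1.1 (1), p.38 l.15–16: «`C/L` has semistable reduction at `v` if and only if `v ∈ V^{odd,ss}`» (semistable =
bad multiplicative here). [claim: Joshi2024ATS4, status: disputed] -/
def Prop411_1 : Prop := ∀ v, 𝓡.red v = .multiplicative ↔ v ∈ 𝓡.Voddss

/-- Proposition 4.1.1 (2), p.38 l.17: «`C/L` has good or additive reduction if `v ∈ {w ∈ V_L : w | (2ℓ)}`».
[claim: Joshi2024ATS4, status: disputed] -/
def Prop411_2 : Prop := ∀ v, 𝓡.DividesTwoEll v → 𝓡.red v = .good ∨ 𝓡.red v = .additive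

/-- Proposition 4.1.1 (3), p.38 l.18–22: «`C/L` has good reduction at `v ∉ V^{odd,ss} ∪ {w ∈ V_L : w | (2ℓ)}`».
[claim: Joshi2024ATS4, status: disputed] -/
def Prop411_3 : Prop := ∀ v, v ∉ 𝓡.Voddss → ¬ 𝓡.DividesTwoEll v → 𝓡.red v = .good

/-- **Proposition 4.1.1** (p.38 l.12–22), the conjunction of (1)–(3), under the standing assumptions «Initial Theta Data
[Joshi 2024c §2.4, §3.1, §3.3] and §4.1.1, §4.1.2»; printed proof (p.38 l.23–24): «This is clear from §4.1.1, §4.1.2 and Initial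
Theta Data». Remark 4.1.3 (p.38 l.30–31): «Thus `C/L` is special elliptic curve. The existence of such an elliptic curve is a
delicate argument of [Mochizuki, 2021d] using [Mochizuki, 2010]» (= [J-IV] Thm. 5.7.1, slot T-28; the cell's [IUTchIV] Cor. 2.2
chain is `Literature.IUT.LogVolume.Corollary22*`). Named `Prop`, never asserted. [claim: Joshi2024ATS4, status: disputed] -/
@[claim "Joshi2024ATS4" "disputed"]
def Prop411 : Prop := 𝓡.Prop411_1 ∧ 𝓡.Prop411_2 ∧ 𝓡.Prop411_3

/-- Part (3) of Proposition 4.1.1 IS hypothesis §4.1.1 (1) (the «clear from §4.1.1» of the printed proof). [folklore] -/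
theorem prop411_3_iff_goodReductionHyp : 𝓡.Prop411_3 ↔ 𝓡.GoodReductionHyp := Iff.rfl

/-- Part (1) of Proposition 4.1.1 follows from part (2): a multiplicative place of residue characteristic `2` would divide
`2ℓ`. [folklore] -/
theorem prop411_1_of_prop411_2 (h2 : 𝓡.Prop411_2) : 𝓡.Prop411_1 := by
  intro v
  refine ⟨fun hv => ⟨?_, hv⟩, fun hv => hv.2⟩
  rcases (residueChar_prime L v).eq_two_or_odd' with h2v | hodd
  · have hdiv : 𝓡.DividesTwoEll v := by rw [DividesTwoEll, h2v]; exact dvd_mul_right 2 _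
    rcases h2 v hdiv with h | h <;> rw [hv] at h <;> exact absurd h (by decide)
  · exact hodd

/-- Hence Proposition 4.1.1 reduces to its part (2) plus hypothesis §4.1.1 (1). [folklore] -/
theorem prop411_of (h1 : 𝓡.GoodReductionHyp) (h2 : 𝓡.Prop411_2) : 𝓡.Prop411 :=
  ⟨𝓡.prop411_1_of_prop411_2 h2, h2, h1⟩

end ReductionDatum

/-! ## 3. Lemma 4.1.2: `Gal(L/L_mod) ↪ ℤ/2 × GL₂(𝔽₂) × GL₂(𝔽₃) × GL₂(𝔽₅)` -/

/-- **Lemma 4.1.2** (p.38 l.25–29): «The extension `L/L_mod` is a composite extension of Galois extensions, it is Galois with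
`Gal(L/L_mod) ↪ ℤ/2 × GL₂(𝔽₂) × GL₂(𝔽₃) × GL₂(𝔽₅)`»; printed proof: «By §4.1.1, §4.1.2, `L/L_mod` is a composite of Galois
extension and the assertions follows from [Lang, 2002, Chap VI, Theorem 1.14]». Typed over genuine fields `L_mod → L`: Galois,
with an injective group homomorphism into the printed product. Named `Prop`, never asserted (cf. the cell's
`IsThetaField.finrank_dvd`, `[F : F_tpd] ∣ |ℤ/2 × GL₂(𝔽₃) × GL₂(𝔽₅)|`, in `Literature.IUT.LogVolume.Corollary22*`).
[claim: Joshi2024ATS4, status: disputed] -/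
@[claim "Joshi2024ATS4" "disputed"]
def GaloisGroupEmbeds (Lmod L : Type*) [Field Lmod] [Field L] [Algebra Lmod L] : Prop :=
  IsGalois Lmod L ∧
    ∃ φ : (L ≃ₐ[Lmod] L) →* Multiplicative (ZMod 2) × Matrix.GeneralLinearGroup (Fin 2) (ZMod 2) ×
        Matrix.GeneralLinearGroup (Fin 2) (ZMod 3) × Matrix.GeneralLinearGroup (Fin 2) (ZMod 5),
      Function.Injective φ

/-! ## 4. §4.2.1: arithmetic divisors, `deg` (4.2.1) and `log` (4.2.2) = the tree's `ADivisor`, `degF`, `ndeg` -/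

section ArithmeticDivisors

variable (M : Type*) [Field M] [NumberField M]

/-- **(4.2.1)** (p.39 l.25–35): «`deg(a_M) = Σ_{v ∈ V^non_M} c_v·log v + Σ_{v ∈ V^arc_M} c_v ∈ ℝ`, where `log v` denotes the
[log of the] cardinality of the residue field of `M_v`» — PROVED for the tree's degree map `degF` of an `ℝ`-arithmetic divisor
`a = Σ c_v·v` (`ADivisor M`, [IUTchIV] Def. 1.9), the nonarchimedean sum taken over any finite set `E` containing the finite
support («`c_v = 0` for all but finitely many `v`», p.39 l.23–24). [folklore] -/
theorem degF_eq_sum_non_add_sum_arc (a : ADivisor M) (E : Finset (HeightOneSpectrum (𝓞 M)))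
    (hE : ∀ v, a (Sum.inr v) ≠ 0 → v ∈ E) :
    degF M a = (∑ v ∈ E, a (Sum.inr v) * logNorm M v) + ∑ v : InfinitePlace M, a (Sum.inl v) := by
  classical
  set T : Finset (Place M) := (Finset.univ : Finset (InfinitePlace M)).map ⟨Sum.inl, Sum.inl_injective⟩ ∪
    E.map ⟨Sum.inr, Sum.inr_injective⟩ with hT
  have hsupp : a.support ⊆ T := by
    rintro (v | v) hv
    · exact Finset.mem_union_left _ (Finset.mem_map.mpr ⟨v, Finset.mem_univ _, rfl⟩)
    · exact Finset.mem_union_right _ (Finset.mem_map.mpr ⟨v, hE v (Finsupp.mem_support_iff.mp hv), rfl⟩)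
  have hdisj : Disjoint ((Finset.univ : Finset (InfinitePlace M)).map ⟨Sum.inl, Sum.inl_injective⟩)
      (E.map ⟨Sum.inr, Sum.inr_injective⟩) := by
    rw [Finset.disjoint_left]
    rintro x hx hx'
    obtain ⟨v, -, rfl⟩ := Finset.mem_map.mp hx
    obtain ⟨w, -, hw⟩ := Finset.mem_map.mp hx'
    exact Sum.inr_ne_inl hw
  rw [degF_apply, Finsupp.sum_of_support_subset a hsupp _ (fun v _ => by rw [zero_mul]), hT,
    Finset.sum_union hdisj, Finset.sum_map, Finset.sum_map, add_comm]
  simp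

/-- **(4.2.2)** (p.39 l.36–38): «`log(a_M) = deg(a_M)/[M : ℚ]` is called the normalized arithmetic degree of `a_M`» — the tree's
`ndeg`. [folklore] -/
theorem ndeg_eq_degF_div (a : ADivisor M) : ndeg M a = degF M a / Module.finrank ℚ M := ndeg_apply M a

end ArithmeticDivisors

/-! ## 5. §4.3: the different `d_M`, the discriminant `disc_{M/ℚ}`, and Proposition 4.3.5 -/

section Different

variable (M : Type*) [Field M] [NumberField M]

/-- «`log(d_M) = (1/[M:ℚ]) Σ_{w ∈ V_M} d_{M,w}·log w`» (p.39 l.49–p.40 l.1), the normalized arithmetic degree of the different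
divisor (4.3.1) `d_M = Σ_w d_{M,w}·w`, `d_{M,w} = ord_w(diff_{𝒪_{M,w}/ℤ_p})` (4.3.2) — typed as `ndeg` of the tree's
`differentDivisor M` (coefficient at `w` = multiplicity of `w` in `𝔇_{𝓞M/ℤ}` = the order of the completed local different, tree
`differentOrd_rescaledCompletion_eq`). [claim: Joshi2024ATS4, status: disputed] -/
def logDifferent : ℝ := ndeg M (differentDivisor M)

/-- (4.3.1)–(4.3.2) unfolded: the coefficient of `d_M` at `w` is `ord_w` of the different ideal. [folklore] -/
theorem differentDivisor_apply_inr (w : HeightOneSpectrum (𝓞 M)) :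
    differentDivisor M (Sum.inr w) = (multiplicity w.asIdeal (differentIdeal ℤ (𝓞 M)) : ℝ) :=
  ADivisor.ofIdeal_apply_inr (differentIdeal_ne_bot' M) w

/-- `d_M` has no archimedean component. [folklore] -/
theorem differentDivisor_apply_inl (w : InfinitePlace M) : differentDivisor M (Sum.inl w) = 0 :=
  ADivisor.ofIdeal_apply_inl _ w

/-- `log(d_M) = log N(𝔇_{𝓞M/ℤ}) / [M:ℚ] = log |disc(M)| / [M:ℚ]` (tree `degF_differentDivisor`, Mathlib
`NumberField.absNorm_differentIdeal`). [folklore] -/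
theorem logDifferent_eq_log_discr :
    logDifferent M = Real.log ((NumberField.discr M).natAbs) / Module.finrank ℚ M := by
  rw [logDifferent, ndeg_apply, degF_differentDivisor]

/-- (4.3.3) (p.40 l.2–8): «`disc_{M/ℚ} = Σ_p ord_p(disc_{M_w/ℤ_p})·p`», the discriminant of `M/ℚ` as an arithmetic divisor on `ℚ`
(`disc_{M_w/ℤ_p} = Norm_{M_w/ℚ_p}(diff_{𝒪_{M,w}/ℤ_p})`, summed over `w ∣ p`) — typed by its coefficients: `ord_p` of Mathlib's
absolute discriminant `NumberField.discr M` (`= N(𝔇_{𝓞M/ℤ})` up to sign, `NumberField.absNorm_differentIdeal`).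
[claim: Joshi2024ATS4, status: disputed] -/
def discOrd (p : ℕ) : ℕ := (NumberField.discr M).natAbs.factorization p

/-- (4.3.4) (p.40 l.9–15): «`log disc_{M/ℚ} = (1/[M:ℚ]) Σ_p ord_p(disc_{M_w/ℤ_p})·log(p)`, its normalized arithmetic degree».
[claim: Joshi2024ATS4, status: disputed] -/
def logDisc : ℝ :=
  (∑ p ∈ (NumberField.discr M).natAbs.primeFactors, (discOrd M p : ℝ) * Real.log p) / Module.finrank ℚ M

/-- `Σ_p ord_p(disc)·log p = log |disc(M)|` (unique factorisation in `ℤ`). [folklore] -/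
theorem sum_discOrd_mul_log :
    ∑ p ∈ (NumberField.discr M).natAbs.primeFactors, (discOrd M p : ℝ) * Real.log p =
      Real.log ((NumberField.discr M).natAbs) := by
  set n : ℕ := (NumberField.discr M).natAbs with hn
  have hn0 : n ≠ 0 := Int.natAbs_ne_zero.mpr (NumberField.discr_ne_zero M)
  conv_rhs => rw [← Nat.prod_factorization_pow_eq_self hn0]
  rw [Finsupp.prod, Nat.support_factorization, Nat.cast_prod,
    Real.log_prod (fun p hp => by exact_mod_cast pow_ne_zero _ (Nat.prime_of_mem_primeFactors hp).ne_zero)]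
  refine Finset.sum_congr rfl fun p _ => ?_
  rw [Nat.cast_pow, Real.log_pow, discOrd]

/-- `log disc_{M/ℚ} = log |disc(M)| / [M:ℚ]`. [folklore] -/
theorem logDisc_eq_log_discr : logDisc M = Real.log ((NumberField.discr M).natAbs) / Module.finrank ℚ M := by
  rw [logDisc, sum_discOrd_mul_log]

/-- **Proposition 4.3.5** (p.40 l.16–17): «Let `M/ℚ` be a finite extension. Then one has the equality `log d_M = log disc_{M/ℚ}`»;
printed proof (p.40 l.18–21): «immediate from the relationship between differents and discriminants of fields [Bombieri and
Gubler, 2006, Proposition B.1.19] … [14.3.8]». PROVED in kernel (no claim involved): `N(𝔇_{𝓞M/ℤ}) = |disc(M)|` is Mathlib's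
`NumberField.absNorm_differentIdeal`. [cite: BombieriGubler2006, Prop. B.1.19] -/
theorem prop435 : logDifferent M = logDisc M := by
  rw [logDifferent_eq_log_discr, logDisc_eq_log_discr]

end Different

end Summit.ABC.IUTFork.Joshi.ATS4
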